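import Literature.NumberTheory.EllipticCurves.YanZhu2026.GreenbergMainTheorems

/-!
# transfer(BSTW) — g31 annex: the cyclotomic CO-ANCHOR run on the SIGNED side (record, NOT a line)

Seat bsd-idea-5 g31 (planner, lens «transfer» at crux level), crux item stmt-BirchSwinnertonDyer-20727
`SignedBaseChange.AnticyclotomicEisensteinDivisibility`.  Companion memo: `Lines/transfer-bstw-census-g31.md`.

HONEST FRAMING.  Nothing here is a new lever: the unit-lifting from the cyclotomic line is BSTW
arXiv:2409.01350 Thm 2.8 (held text p.76 L86–107, "cf. [SU]") and is ALREADY booked in this crux directory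
by idea «vertss» v1.2 (bsd-idea-14) — SCOPE NOTE «the cyclotomic CO-ANCHOR» + `IdeaSketchVertss.lean` — and
dismissed for route SignedBaseChange in `Cruxes/TwistPairGreenbergProductDivisibilitySplit/Lines/acanchor.md`
l.133 («circular for X7»).  This file only RECORDS, kernel-checked and over an abstract coefficient domain `A`,
the remark that the co-anchor can be run on the SIGNED side, where the non-vanishing it needs is Rohrlich's
(`LL ≠ 0`: the product of the two signed cyclotomic `p`-adic `L`-functions is a non-zero power series, every
rank) instead of `G⁺ ≠ 0` on the Greenberg side (= idea-14's door (7), open in analytic rank ≥ 3).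
Inputs named by the hypotheses of `span_eq_span_of_signedCoanchor`:
* `hES`  : `G ∈ (F)` — the two-variable Euler-system divisibility = sibling crux 20728 (idea-14's), after a
           generator `F` of the pushed-forward characteristic ideal (`SignedBaseChangeK1Acanchor.charIdealIsPrincipal₂`);
* `hP1`  : `(ξ_∘·G) = (F)·(𝓛^∘)` — (P1) of the crux's OWN hypothesis h.2
           (`BurungaleSkinnerTianWan2024.props118_27_519_exists_signedTwoVariablePackage_supersingular_PRE`);
* `hP3`  : `cyc 𝓛^∘ ~ LL` with `LL = J(L₁^ε·L₂^ε)` — (P3) of the same package;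
* `hKob` : `LL ~ gg` with `gg = J(g₁·g₂)` — Kobayashi's main conjecture as an EQUALITY for `E` AND `E^{(D_K)}` at a
           COMMON sign `ε` (crux 19001-type content ×2; THIS is the first non-transferring step of BSTW Thm 2.8 at
           arbitrary `N` over a Heegner field — see the memo §2, §4);
* `hP2`  : `cyc ξ_∘ ~ gg` — LINE PURITY on the cyclotomic line (BSTW Prop 2.7 iso form, PRE; Lei–Palvannan
           arXiv:1806.07214 Prop. (cyclosp) p.40 with Palvannan's specialisation Prop. 5.2);
* `hLL`  : `LL ≠ 0` — Rohrlich.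
Conclusion `(F) = (G)`: two-variable EQUALITY, whence 20727 (`crux_shape`, second component) and 20728 as an equality.
Modulo these inputs 20727 is therefore EQUIVALENT to the common-sign Kobayashi pair (the converse is the route's own
descent) — the «triangle» of the memo §3; on the square-free locus this is BSTW's theorem, which is why the co-anchor is
circular for the summit and why no crux idea card is filed by g31.

BSD is not proved by any of this; no instance of the crux, of Kobayashi's main conjecture or of any summit statement
is certified here — every arithmetic input above is a HYPOTHESIS of the lemmas below.
-/

set_option linter.dupNamespace false

noncomputable section

namespace Summit.BirchSwinnertonDyer.BirchSwinnertonDyer.Cruxes.AnticyclotomicEisensteinDivisibility.TransferBstwG31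

open PowerSeries

section Abstract

variable {A : Type*} [CommRing A]

/-- Restriction of a two-variable series `u ∈ A⟦T₂⟧⟦T₁⟧` (outer variable `T₁` = cyclotomic, inner `T₂` =
anticyclotomic, the tree's convention for `IwasawaAlgebra₂` / `UnrSeries₂`) to the CYCLOTOMIC line `T₂ = 0`:
kill the inner variable.  At `A = 𝒪_{ℂ_p}` this is `UnrSeries₂.plus` (`cyc_eq_plus` below, `rfl`). -/
def cyc : PowerSeries (PowerSeries A) →+* PowerSeries A :=
  PowerSeries.map PowerSeries.constantCoeff

theorem cyc_apply (u : PowerSeries (PowerSeries A)) :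
    cyc u = PowerSeries.map PowerSeries.constantCoeff u := rfl

/-- The double constant coefficient `u(0,0)` is the constant coefficient of the cyclotomic restriction. -/
theorem constantCoeff_cyc (u : PowerSeries (PowerSeries A)) :
    PowerSeries.constantCoeff (cyc u) = PowerSeries.constantCoeff (PowerSeries.constantCoeff u) := by
  rw [cyc_apply, ← PowerSeries.coeff_zero_eq_constantCoeff_apply, PowerSeries.coeff_map,
    PowerSeries.coeff_zero_eq_constantCoeff_apply]

/-- KERNEL RIGIDITY: a two-variable power series is a unit iff its cyclotomic restriction is (iff `u(0,0)` is). -/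
theorem isUnit_iff_isUnit_cyc (u : PowerSeries (PowerSeries A)) : IsUnit u ↔ IsUnit (cyc u) := by
  rw [PowerSeries.isUnit_iff_constantCoeff, PowerSeries.isUnit_iff_constantCoeff,
    PowerSeries.isUnit_iff_constantCoeff (φ := cyc u), constantCoeff_cyc]

variable [IsDomain A]

/-- **The co-anchor on the signed side (abstract form of BSTW Thm 2.8's unit-lifting, Euler-system orientation).**
`F` = a generator of the pushed-forward two-variable characteristic ideal, `G` = the two-variable Greenberg/BDP
function, `xi` = `ξ_∘` (signed two-variable characteristic series), `Lsig` = `𝓛^∘` (signed two-variable `p`-adic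
`L`-function), `LL` = `J(L₁^ε L₂^ε)`, `gg` = `J(g₁ g₂)` (one-variable, on the cyclotomic line).  See the module
docstring for which tree statement each hypothesis names.  No arithmetic is proved: pure commutative algebra in the
domain `A⟦T₂⟧⟦T₁⟧`. -/
theorem span_eq_span_of_signedCoanchor
    {F G xi Lsig : PowerSeries (PowerSeries A)} {LL gg : PowerSeries A}
    (hES : G ∈ Ideal.span {F})
    (hP1 : Ideal.span {xi * G} = Ideal.span {F} * Ideal.span {Lsig})
    (hP3 : Associated (cyc Lsig) LL) (hKob : Associated LL gg) (hP2 : Associated (cyc xi) gg)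
    (hLL : LL ≠ 0) :
    Ideal.span {F} = Ideal.span {G} := by
  obtain ⟨u, rfl⟩ := Ideal.mem_span_singleton'.mp hES
  -- now `G = u * F`
  by_cases hF : F = 0
  · simp [hF]
  -- cancel `F`:  `xi * u ~ Lsig`
  have h1 : Associated (F * (xi * u)) (F * Lsig) := by
    rw [Ideal.span_singleton_mul_span_singleton] at hP1
    have := Ideal.span_singleton_eq_span_singleton.mp hP1
    simpa [mul_comm, mul_left_comm, mul_assoc] using this
  have h2 : Associated (xi * u) Lsig := Associated.of_mul_left h1 (Associated.refl F) hF
  -- restrict to the cyclotomic line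
  have h3 : Associated (cyc xi * cyc u) (cyc xi * 1) := by
    have h := (h2.map cyc)
    rw [map_mul] at h
    rw [mul_one]
    exact h.trans (hP3.trans (hKob.trans hP2.symm))
  have hxi : cyc xi ≠ 0 := by
    rw [hP2.ne_zero_iff, ← hKob.ne_zero_iff]
    exact hLL
  have h4 : Associated (cyc u) 1 := Associated.of_mul_left h3 (Associated.refl _) hxi
  have hu : IsUnit u := (isUnit_iff_isUnit_cyc u).mpr (associated_one_iff_isUnit.mp h4)
  rw [Ideal.span_singleton_mul_left_unit hu]

/-- The same door in the CRUX'S SHAPE: for the pushed-forward characteristic ideal `I = (F)`, the inputs give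
`I = (G)` (two-variable equality, so 20728 as an equality) AND the anticyclotomic-line containment
`I|_{T₁ = 0} ⊆ (G⁻)` with `G⁻ = constantCoeff G` — literally the conclusion pattern of 20727
(`… .map PowerSeries.constantCoeff ≤ Ideal.span {UnrSeries₂.minus G}`). -/
theorem crux_shape
    {I : Ideal (PowerSeries (PowerSeries A))} {F G xi Lsig : PowerSeries (PowerSeries A)} {LL gg : PowerSeries A}
    (hI : I = Ideal.span {F})
    (hES : G ∈ I)
    (hP1 : Ideal.span {xi * G} = I * Ideal.span {Lsig})
    (hP3 : Associated (cyc Lsig) LL) (hKob : Associated LL gg) (hP2 : Associated (cyc xi) gg)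
    (hLL : LL ≠ 0) :
    I = Ideal.span {G} ∧
      I.map (PowerSeries.constantCoeff (R := PowerSeries A)) ≤ Ideal.span {PowerSeries.constantCoeff G} := by
  subst hI
  have h := span_eq_span_of_signedCoanchor hES hP1 hP3 hKob hP2 hLL
  refine ⟨h, ?_⟩
  rw [h, Ideal.map_span, Set.image_singleton]

end Abstract

section Instance

open Literature.NumberTheory.EllipticCurves

variable {p : ℕ} [Fact p.Prime]

/-- At `A = 𝒪_{ℂ_p}` the abstract cyclotomic restriction IS the tree's `UnrSeries₂.plus`. -/
theorem cyc_eq_plus (G : PowerSeries (PowerSeries (PadicComplexInt p))) : cyc G = UnrSeries₂.plus G := rfl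

/-- … and the anticyclotomic restriction used by the crux is `UnrSeries₂.minus = constantCoeff`. -/
theorem minus_eq_constantCoeff (G : PowerSeries (PowerSeries (PadicComplexInt p))) :
    UnrSeries₂.minus G = PowerSeries.constantCoeff G := rfl

/-- Kernel rigidity in the tree's vocabulary: a two-variable unramified series is a unit iff `G⁺` is. -/
theorem isUnit_iff_isUnit_plus (u : PowerSeries (PowerSeries (PadicComplexInt p))) :
    IsUnit u ↔ IsUnit (UnrSeries₂.plus u) := isUnit_iff_isUnit_cyc u

end Instance

end Summit.BirchSwinnertonDyer.BirchSwinnertonDyer.Cruxes.AnticyclotomicEisensteinDivisibility.TransferBstwG31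

end
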